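import Summits.ResolutionOfSingularities.ResolutionOfSingularities.Theses.WildQuotients
import Summits.ResolutionOfSingularities.ResolutionOfSingularities.Theorems.WildQuotientsWildQuotientResolutionTameQuotientCharts
import HarnessLib

/-!
# `WildQuotients.TameQuotientResolution` (stmt-ResolutionOfSingularities-15645) modulo Bergh–Rydh

[OURS · L1 W4.5c; NOT a statement of the manuscript.] Route `ResolutionOfSingularities/WildQuotients`,
support item `TameQuotientResolution` (rank 9): resolution of Galois-type quotients `X₁` of a
REGULAR integral `X′` by a finite group `G` of order prime to `p` over a PERFECT field `k` of
characteristic `p`. This file proves the item CONDITIONALLY on the named fact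
`Literature.AlgebraicGeometry.Resolution.BerghRydh2019_tameQuotientResolution` (Bergh–Rydh 2019,
Thm. 5, constant tame groups — an undischarged `def … : Prop`, hypothesis `hBR`):
`tameQuotientResolution_of_berghRydh : BerghRydh2019_tameQuotientResolution →
TameQuotientResolution`. All the work — the glued quotient `X′/G → X₁` is proper birational and
`X′/G` is covered by OPEN charts `Spec S^G` over `k` with `S` regular of finite type, i.e. has
finite tame quotient singularities — is the route-independent
`Theorems/WildQuotientsWildQuotientResolutionTameQuotientCharts.lean`
(`TameQuotient.hasResolution_of_faithful_of_berghRydh`); here only the reduction to a faithful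
action (`G ⧸ ker ρ`, of order dividing `|G|`, hence still prime to `p`) is added. The tree's
earlier `Theorems/WildQuotientsTameQuotientResolution.lean` had the chart form
(`hasResolution_of_tame_regular_charts`) and named exactly this glue as missing.
-/

-- single-problem summit: the doubled namespace component `ResolutionOfSingularities` is forced
set_option linter.dupNamespace false

noncomputable section

open CategoryTheory AlgebraicGeometry
open Literature.AlgebraicGeometry.Resolution

namespace Summit.ResolutionOfSingularities.ResolutionOfSingularities.Theorems.WildQuotientResolution.TameQuotient

/-- **`TameQuotientResolution` (stmt-ResolutionOfSingularities-15645) modulo Bergh–Rydh 2019,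
Thm. 5**: assuming the named fact `BerghRydh2019_tameQuotientResolution` (constant tame groups,
`k` perfect), every Galois-type quotient `X₁` of a regular integral `X′` by a finite group `G` of
order prime to `p` over a perfect field of characteristic `p` has a resolution of singularities.
Reduction to the faithful case `hasResolution_of_faithful_of_berghRydh`: the action factors
through the faithful action of `G ⧸ ker ρ` (`QuotientGroup.kerLift`), whose order divides `|G|`
and is therefore still prime to `p`; `q` stays invariant and its fibres are still the orbits.
CONDITIONAL on the named fact (a `conditional-result` for the item, not a closure).
[cite: BerghRydh2019, Thm 5 (arXiv:1905.00872, p. 4)] -/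
theorem tameQuotientResolution_of_berghRydh (hBR : BerghRydh2019_tameQuotientResolution) :
    Theses.WildQuotients.TameQuotientResolution := by
  intro p hp k _ _ _ X' X₁ f q G _ _ ρ hcop hsep hlft hqc hX₁ hX' hreg hfin hsurj hU hρ horb
  haveI := hsep
  haveI := hlft
  haveI := hqc
  haveI := hX₁
  haveI := hX'
  haveI := hfin
  -- pass to the faithful action of `G ⧸ ker ρ`
  have hcop' : Nat.Coprime (Nat.card (G ⧸ ρ.ker)) p :=
    Nat.Coprime.coprime_dvd_left (Subgroup.card_quotient_dvd_card ρ.ker) hcop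
  refine hasResolution_of_faithful_of_berghRydh hBR hp k X' X₁ f q (G ⧸ ρ.ker)
    (QuotientGroup.kerLift ρ) hcop' (QuotientGroup.kerLift_injective ρ) hreg hsurj hU ?_ ?_
  · intro g
    induction g using QuotientGroup.induction_on with
    | H g => rw [QuotientGroup.kerLift_mk]; exact hρ g
  · intro x y hxy
    obtain ⟨g, hg⟩ := horb x y hxy
    exact ⟨(g : G ⧸ ρ.ker), by rw [QuotientGroup.kerLift_mk]; exact hg⟩

end Summit.ResolutionOfSingularities.ResolutionOfSingularities.Theorems.WildQuotientResolution.TameQuotient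

end
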